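import Summits.QuantumAdvantage.QuantumAdvantage.Theorems.OddPrimeWalkSimplexFrames

/-!
# The counter gadget: zero-sum triples in a common weight class mod `q` (engine for item stmt-QuantumAdvantage-24098 `CounterAffinePairLaw`)

Cell qa-qnc0, route OddPrimeWalk (support, rank 9); planner qa-qnc0-p2 g30 (ROUND-30 §2, THM 30-A, brief P2-30a);
prover qn-prover-3 g19.

SETTING.  The u-walk game `ringWinU c y` across a separator `m`; a cut `g ≤ m` is COUNTER-AFFINE in the foreign bits `≥ m`
if `y g u = a₀(v, ρ) ⊕ ⟨A(v, ρ), x⟩` with `v` = own bits, `x` = foreign bits, `ρ = |x| mod q`, `a₀, A` arbitrary; symmetrically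
for cuts `g > m`.  `q % 3 ≠ 0`.

THE GADGET (§3–§4).  On a ground block `[β, β + gadL q)`, `gadL q = 3(1 + 2q)`, for `t : Fin 3` put `ℓ = 1 + tq` and the three
consecutive interval indicators `I = 1_[β, β+ℓ)`, `J = 1_[β+ℓ, β+2ℓ)`, `K = 1_[β+2ℓ, β+3ℓ)`; the triple `gad β q t s` (`s : Fin 3`) is
`I ⊕ J, J ⊕ K, I ⊕ K`: it is ZERO-SUM coordinatewise (`gad_zero_sum`) and all three members have weight `gadW q t = 2(1 + tq)`
(`wt_gad`) — `≡ 2 (mod q)` for every `t`, and, since `3 ∤ q`, in the three distinct classes mod `3` (`card_gadW_eq_one`).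
DESIGN (§5).  Index `Fin 3 × Fin 3` (odd); slots `rA ⊕ gad (m − gadL q) q t s` (near, base `rA` below `m − gadL q`) and
`rB ⊕ gad m q t s` (far, base `rB` from `m + gadL q` on).
THEOREM `counter_exists_lose` (§6): under the filed counter-affine hypotheses of item 24098 some glued slot pair is LOST.  Proof =
the planner's `configParity` (file `OddPrimeWalkOddConfig`) with `hindA/hindB` from `count_parity3`: all nine far slots share
`ρ = (|rB| + 2) mod q`, so for a fixed cut and a fixed near slot the affine data `(a₀, A)` is FIXED, and the `𝔽₂`-sum of the fire
bits over a triple is `a₀ + ⟨A, rB⟩` (three copies of the base, zero-sum gadget) — independent of the triple (`(C2)` of ROUND-30 §2).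
The averaging step and the closer are in `OddPrimeWalkCounterAffinePairLaw`.
WHAT THIS IS NOT: instrument (a bankable law of the u-walk game; contains the (CORR-η) extremiser family); the dense cruxes
23029/23109 are not touched; separation NOT moved.
-/

namespace Summit.QuantumAdvantage.AdviceFreeQNC0.OddConfig

open Finset Classical Literature.Computability.QuantumComplexity

variable {n : ℕ}

/-! ### §1 Parity bookkeeping in `ZMod 2` -/

/-- `indZ` is additive over `xor`. -/
theorem indZ_xor (a b : Bool) : indZ (xor a b) = indZ a + indZ b := by
  cases a <;> cases b <;> decide

/-- the parity bit of `N`, read in `ZMod 2`, is the residue of `N`. -/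
theorem indZ_decide_odd (N : ℕ) : indZ (decide (N % 2 = 1)) = (N : ZMod 2) := by
  rcases Nat.mod_two_eq_zero_or_one N with h | h
  · rw [ZMod.natCast_eq_zero_iff_even.mpr (Nat.even_iff.mpr h)]; simp [indZ, h]
  · rw [ZMod.natCast_eq_one_iff_odd.mpr (Nat.odd_iff.mpr h)]; simp [indZ, h]

/-- the cardinality of a Boolean filter, in `ZMod 2`, is the sum of the indicator bits. -/
theorem card_filter_zmod (A : Finset (Fin n)) (u : Fin n → Bool) :
    (((A.filter fun k => u k = true).card : ℕ) : ZMod 2) = ∑ k ∈ A, indZ (u k) := by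
  rw [natCast_card_filter]; rfl

/-- indicator bits of a pointwise xor split. -/
theorem sum_indZ_addV (A : Finset (Fin n)) (u z : Fin n → Bool) :
    (∑ k ∈ A, indZ (addV u z k)) = (∑ k ∈ A, indZ (u k)) + ∑ k ∈ A, indZ (z k) := by
  rw [← sum_add_distrib]; exact sum_congr rfl fun k _ => indZ_xor (u k) (z k)

/-! ### §2 The class-count parity over an index `Fin 3 × ι` -/

/-- **generic class-count parity** (the `Fin 3 × ι` form of `count_parity`): if the three triples land in distinct residue
classes mod `3` and every triple sum of fire bits is `x`, then every class count has parity `x`. -/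
theorem count_parity3 {ι : Type} [Fintype ι] (res : Fin 3 → ℕ)
    (hres : ∀ b < 3, (univ.filter fun t : Fin 3 => res t % 3 = b).card = 1)
    (fire : Fin 3 → ι → Bool) (x : ZMod 2) (hfire : ∀ t, (∑ s, indZ (fire t s)) = x)
    (cls : Fin 3 × ι → ℕ) (hcls : ∀ j, cls j % 3 = res j.1 % 3) {b : ℕ} (hb : b < 3) :
    (((univ.filter fun j : Fin 3 × ι => cls j % 3 = b ∧ fire j.1 j.2 = true).card : ℕ) : ZMod 2) = x := by
  rw [natCast_card_filter, Fintype.sum_prod_type]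
  have hinner : ∀ t : Fin 3, (∑ s : ι, (if cls (t, s) % 3 = b ∧ fire t s = true then (1 : ZMod 2) else 0))
      = if res t % 3 = b then x else 0 := by
    intro t
    by_cases h : res t % 3 = b
    · rw [if_pos h, ← hfire t]
      refine sum_congr rfl fun s _ => ?_
      rw [hcls (t, s)]; simp [h, indZ]
    · rw [if_neg h]
      refine sum_eq_zero fun s _ => ?_
      rw [hcls (t, s)]; simp [h]
  simp_rw [hinner]
  rw [← sum_filter, sum_const, hres b hb, one_smul]

/-! ### §3 The gadget weights `2(1 + tq)` and their residues -/

/-- the gadget weights `gadW q t = 2(1 + tq)`, `t = 0, 1, 2`. -/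
def gadW (q : ℕ) (t : Fin 3) : ℕ := 2 * (1 + t.val * q)

/-- the length of the gadget ground block: `3(1 + 2q)`. -/
def gadL (q : ℕ) : ℕ := 3 * (1 + 2 * q)

/-- the gadget weights are `≡ 2 (mod q)`. -/
theorem gadW_mod (q c : ℕ) (t : Fin 3) : (c + gadW q t) % q = (c + 2) % q := by
  have e : c + gadW q t = c + 2 + (2 * t.val) * q := by unfold gadW; ring
  rw [e, Nat.add_mul_mod_self_right]

/-- for `3 ∤ q` and every offset `c`, exactly one gadget weight lands in each residue class mod `3`. -/
theorem card_gadW_eq_one {q : ℕ} (hq : q % 3 ≠ 0) (c : ℕ) {b : ℕ} (hb : b < 3) :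
    (univ.filter fun t : Fin 3 => (c + gadW q t) % 3 = b).card = 1 := by
  have e : (univ.filter fun t : Fin 3 => (c + gadW q t) % 3 = b)
      = univ.filter fun t : Fin 3 => (c % 3 + 2 + 2 * (t.val * (q % 3))) % 3 = b := by
    refine filter_congr fun t _ => ?_
    have ht : t = 0 ∨ t = 1 ∨ t = 2 := by fin_cases t <;> simp
    rcases ht with rfl | rfl | rfl <;> simp [gadW] <;> omega
  rw [e]
  have hc : c % 3 < 3 := Nat.mod_lt _ (by norm_num)
  have hq12 : q % 3 = 1 ∨ q % 3 = 2 := by omega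
  generalize hc' : c % 3 = c' at hc ⊢
  rcases hq12 with h | h <;> rw [h] <;> interval_cases c' <;> interval_cases b <;> decide

/-! ### §4 The gadget vectors: three zero-sum interval triples on a ground block -/

/-- indicator vector of the interval block `[a, a + ℓ)`. -/
def ivlV (n a ℓ : ℕ) : Fin n → Bool := fun k => decide (k ∈ ivl n a ℓ)

/-- membership in an interval indicator. -/
theorem ivlV_true {a ℓ : ℕ} {k : Fin n} : ivlV n a ℓ k = true ↔ a ≤ k.val ∧ k.val < a + ℓ := by
  simp [ivlV, ivl]

/-- weight of an interval indicator. -/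
theorem wt_ivlV {a ℓ : ℕ} (h : a + ℓ ≤ n) : wt (ivlV n a ℓ) = ℓ := by
  unfold ivlV; rw [wt_indicator, card_ivl h]

/-- the triple on three consecutive intervals `I, J, K` of length `ℓ` from `β`: `I ⊕ J`, `J ⊕ K`, `I ⊕ K`. -/
def gadV (n β ℓ : ℕ) (s : Fin 3) : Fin n → Bool :=
  if s.val = 0 then addV (ivlV n β ℓ) (ivlV n (β + ℓ) ℓ)
  else if s.val = 1 then addV (ivlV n (β + ℓ) ℓ) (ivlV n (β + 2 * ℓ) ℓ)
  else addV (ivlV n β ℓ) (ivlV n (β + 2 * ℓ) ℓ)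

/-- slot `0` of the triple. -/
theorem gadV_zero (β ℓ : ℕ) : gadV n β ℓ 0 = addV (ivlV n β ℓ) (ivlV n (β + ℓ) ℓ) := by simp [gadV]

/-- slot `1` of the triple. -/
theorem gadV_one (β ℓ : ℕ) : gadV n β ℓ 1 = addV (ivlV n (β + ℓ) ℓ) (ivlV n (β + 2 * ℓ) ℓ) := by simp [gadV]

/-- slot `2` of the triple. -/
theorem gadV_two (β ℓ : ℕ) : gadV n β ℓ 2 = addV (ivlV n β ℓ) (ivlV n (β + 2 * ℓ) ℓ) := by simp [gadV]

/-- **the triple is zero-sum**, coordinatewise in `ZMod 2`. -/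
theorem gadV_zero_sum (β ℓ : ℕ) (k : Fin n) :
    indZ (gadV n β ℓ 0 k) + indZ (gadV n β ℓ 1 k) + indZ (gadV n β ℓ 2 k) = 0 := by
  rw [gadV_zero, gadV_one, gadV_two]
  simp only [addV, indZ_xor]
  linear_combination (indZ (ivlV n β ℓ k) + indZ (ivlV n (β + ℓ) ℓ k) + indZ (ivlV n (β + 2 * ℓ) ℓ k)) *
    QuadPolar.two_eq_zero

/-- an `addV` bit is set only if one of the summand bits is. -/
theorem addV_true_cases {x y : Fin n → Bool} {k : Fin n} (h : addV x y k = true) : x k = true ∨ y k = true := by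
  simp only [addV] at h
  cases hx : x k <;> cases hy : y k <;> simp_all

/-- the triple is supported in `[β, β + 3ℓ)`. -/
theorem gadV_supp (β ℓ : ℕ) (s : Fin 3) (k : Fin n) (hk : gadV n β ℓ s k = true) : β ≤ k.val ∧ k.val < β + 3 * ℓ := by
  have hs : s = 0 ∨ s = 1 ∨ s = 2 := by fin_cases s <;> simp
  rcases hs with rfl | rfl | rfl
  · rw [gadV_zero] at hk
    rcases addV_true_cases hk with h | h <;> rw [ivlV_true] at h <;> omega
  · rw [gadV_one] at hk
    rcases addV_true_cases hk with h | h <;> rw [ivlV_true] at h <;> omega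
  · rw [gadV_two] at hk
    rcases addV_true_cases hk with h | h <;> rw [ivlV_true] at h <;> omega

/-- **all three members of the triple have weight `2ℓ`.** -/
theorem wt_gadV {β ℓ : ℕ} (h : β + 3 * ℓ ≤ n) (s : Fin 3) : wt (gadV n β ℓ s) = 2 * ℓ := by
  have hs : s = 0 ∨ s = 1 ∨ s = 2 := by fin_cases s <;> simp
  rcases hs with rfl | rfl | rfl
  · rw [gadV_zero, wt_addV_of_disjoint, wt_ivlV (by omega), wt_ivlV (by omega)]
    · ring
    · rintro k ⟨h1, h2⟩; rw [ivlV_true] at h1 h2; omega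
  · rw [gadV_one, wt_addV_of_disjoint, wt_ivlV (by omega), wt_ivlV (by omega)]
    · ring
    · rintro k ⟨h1, h2⟩; rw [ivlV_true] at h1 h2; omega
  · rw [gadV_two, wt_addV_of_disjoint, wt_ivlV (by omega), wt_ivlV (by omega)]
    · ring
    · rintro k ⟨h1, h2⟩; rw [ivlV_true] at h1 h2; omega

/-- **the gadget**: on the ground block from `β`, the triple `t` uses intervals of length `1 + tq`. -/
def gad (β q : ℕ) (t s : Fin 3) : Fin n → Bool := gadV n β (1 + t.val * q) s

/-- `t·q ≤ 2q` for `t : Fin 3`. -/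
theorem fin3_mul_le (q : ℕ) (t : Fin 3) : t.val * q ≤ 2 * q := Nat.mul_le_mul_right q (by have := t.isLt; omega)

/-- the gadget is zero-sum coordinatewise. -/
theorem gad_zero_sum (β q : ℕ) (t : Fin 3) (k : Fin n) :
    indZ (gad (n := n) β q t 0 k) + indZ (gad (n := n) β q t 1 k) + indZ (gad (n := n) β q t 2 k) = 0 :=
  gadV_zero_sum β _ k

/-- the gadget is supported in the ground block `[β, β + gadL q)`. -/
theorem gad_supp (β q : ℕ) (t s : Fin 3) (k : Fin n) (hk : gad β q t s k = true) : β ≤ k.val ∧ k.val < β + gadL q := by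
  have h := gadV_supp β _ s k hk
  have := fin3_mul_le q t
  unfold gadL; omega

/-- **weights of the gadget**: `|gad β q t s| = gadW q t = 2(1 + tq)` for all three slots `s`. -/
theorem wt_gad {β q : ℕ} (h : β + gadL q ≤ n) (t s : Fin 3) : wt (gad (n := n) β q t s) = gadW q t := by
  unfold gad gadW
  have := fin3_mul_le q t
  exact wt_gadV (by unfold gadL at h; omega) s

/-! ### §5 The design slots across the separator -/

section Slots

variable {m q : ℕ}

/-- near design slots: base `rA` plus the gadget on the near ground block `[m − gadL q, m)`. -/
def slotA (m q : ℕ) (rA : Fin n → Bool) (i : Fin 3 × Fin 3) : Fin n → Bool := addV rA (gad (m - gadL q) q i.1 i.2)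

/-- far design slots: base `rB` plus the gadget on the far ground block `[m, m + gadL q)`. -/
def slotB (m q : ℕ) (rB : Fin n → Bool) (j : Fin 3 × Fin 3) : Fin n → Bool := addV rB (gad m q j.1 j.2)

/-- near slots vanish on the far side. -/
theorem slotA_far (hLm : gadL q ≤ m) (rA : Fin n → Bool) (hrA : ∀ k, rA k = true → k.val < m - gadL q)
    (i : Fin 3 × Fin 3) (k : Fin n) (hk : ¬ k.val < m) : slotA m q rA i k = false := by
  have h1 : rA k = false := by
    by_contra h; have := hrA k (by simpa using h); omega
  have h2 : gad (m - gadL q) q i.1 i.2 k = false := by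
    by_contra h; have := (gad_supp _ _ _ _ k (by simpa using h)).2; omega
  simp [slotA, addV, h1, h2]

/-- far slots vanish on the near side. -/
theorem slotB_near (rB : Fin n → Bool) (hrB : ∀ k, rB k = true → m + gadL q ≤ k.val)
    (j : Fin 3 × Fin 3) (k : Fin n) (hk : k.val < m) : slotB m q rB j k = false := by
  have h1 : rB k = false := by
    by_contra h; have := hrB k (by simpa using h); omega
  have h2 : gad m q j.1 j.2 k = false := by
    by_contra h; have := (gad_supp _ _ _ _ k (by simpa using h)).1; omega
  simp [slotB, addV, h1, h2]

/-- **weights of the far slots**: `|rB| + gadW q t`. -/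
theorem wtB_slotB (hnB : m + gadL q ≤ n) (rB : Fin n → Bool) (hrB : ∀ k, rB k = true → m + gadL q ≤ k.val)
    (j : Fin 3 × Fin 3) : wtB m (slotB m q rB j) = wtB m rB + gadW q j.1 := by
  unfold slotB
  rw [wtB_addV_of_disjoint, wtB_eq_wt_of_far m (gad m q j.1 j.2) (fun k hk => (gad_supp _ _ _ _ k hk).1), wt_gad hnB]
  rintro k ⟨h1, h2⟩
  have a := hrB k h1; have b := (gad_supp _ _ _ _ k h2).2; omega

/-- **weights of the near slots**: `|rA| + gadW q t`. -/
theorem wtA_slotA (hLm : gadL q ≤ m) (hmn : m ≤ n) (rA : Fin n → Bool) (hrA : ∀ k, rA k = true → k.val < m - gadL q)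
    (i : Fin 3 × Fin 3) : wtA m (slotA m q rA i) = wtA m rA + gadW q i.1 := by
  unfold slotA
  rw [wtA_addV_of_disjoint, wtA_eq_wt_of_near m (gad (m - gadL q) q i.1 i.2)
    (fun k hk => by have := (gad_supp _ _ _ _ k hk).2; omega), wt_gad (by omega)]
  rintro k ⟨h1, h2⟩
  have a := hrA k h1; have b := (gad_supp _ _ _ _ k h2).1; omega

end Slots

/-! ### §6 Reading a glued input: own part, foreign count, foreign parity set -/

/-- the own part (bits `< m`) of a glued input is the own part of the first argument. -/
theorem own_lt_glue (m : ℕ) (s s' : Fin n → Bool) :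
    (fun k : Fin n => decide (k.val < m) && glue m s s' k) = fun k => decide (k.val < m) && s k := by
  funext k; by_cases hk : k.val < m <;> simp [glue, hk]

/-- the own part (bits `≥ m`) of a glued input is the own part of the second argument. -/
theorem own_ge_glue (m : ℕ) (s s' : Fin n → Bool) :
    (fun k : Fin n => decide (m ≤ k.val) && glue m s s' k) = fun k => decide (m ≤ k.val) && s' k := by
  funext k
  by_cases hk : k.val < m
  · have : ¬ m ≤ k.val := not_le.mpr hk
    simp [glue, hk, this]
  · simp [glue, hk]

/-- the far count of a glued input is the far weight of the second argument. -/
theorem cnt_ge_glue (m : ℕ) (s s' : Fin n → Bool) :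
    (univ.filter fun k : Fin n => m ≤ k.val ∧ glue m s s' k = true).card = wtB m s' := by
  unfold wtB; congr 1; ext k
  simp only [mem_filter, mem_univ, true_and, not_lt]
  constructor
  · rintro ⟨h1, h2⟩; exact ⟨h1, by rwa [glue_apply_not_lt _ _ (not_lt.mpr h1)] at h2⟩
  · rintro ⟨h1, h2⟩; exact ⟨h1, by rw [glue_apply_not_lt _ _ (not_lt.mpr h1)]; exact h2⟩

/-- the near count of a glued input is the near weight of the first argument. -/
theorem cnt_lt_glue (m : ℕ) (s s' : Fin n → Bool) :
    (univ.filter fun k : Fin n => k.val < m ∧ glue m s s' k = true).card = wtA m s := by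
  unfold wtA; congr 1; ext k
  simp only [mem_filter, mem_univ, true_and]
  constructor
  · rintro ⟨h1, h2⟩; exact ⟨h1, by rwa [glue_apply_lt _ _ h1] at h2⟩
  · rintro ⟨h1, h2⟩; exact ⟨h1, by rw [glue_apply_lt _ _ h1]; exact h2⟩

/-- the far parity set of a glued input only sees the second argument. -/
theorem filter_ge_glue (A : Finset (Fin n)) (m : ℕ) (s s' : Fin n → Bool) :
    (A.filter fun k : Fin n => m ≤ k.val ∧ glue m s s' k = true)
      = (A.filter fun k : Fin n => m ≤ k.val).filter fun k => s' k = true := by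
  rw [filter_filter]
  refine filter_congr fun k _ => ?_
  constructor
  · rintro ⟨h1, h2⟩; exact ⟨h1, by rwa [glue_apply_not_lt _ _ (not_lt.mpr h1)] at h2⟩
  · rintro ⟨h1, h2⟩; exact ⟨h1, by rw [glue_apply_not_lt _ _ (not_lt.mpr h1)]; exact h2⟩

/-- the near parity set of a glued input only sees the first argument. -/
theorem filter_lt_glue (A : Finset (Fin n)) (m : ℕ) (s s' : Fin n → Bool) :
    (A.filter fun k : Fin n => k.val < m ∧ glue m s s' k = true)
      = (A.filter fun k : Fin n => k.val < m).filter fun k => s k = true := by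
  rw [filter_filter]
  refine filter_congr fun k _ => ?_
  constructor
  · rintro ⟨h1, h2⟩; exact ⟨h1, by rwa [glue_apply_lt _ _ h1] at h2⟩
  · rintro ⟨h1, h2⟩; exact ⟨h1, by rw [glue_apply_lt _ _ h1]; exact h2⟩

/-! ### §7 The design has a lost pair under counter-affine far reading -/

section Counter

variable {m q : ℕ}

/-- **THE COUNTER DESIGN HAS A LOST PAIR.**  `3 ∤ q`; cuts `g ≤ m` counter-affine in the bits `≥ m` (affine on each class
`#far ones ≡ ρ (mod q)`, data depending arbitrarily on the own bits and on `ρ`), cuts `g > m` counter-affine in the bits `< m`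
(the filed hypotheses of item 24098); a near base `rA` supported below `m − gadL q` and a far base `rB` supported from
`m + gadL q` on: among the `81` glued slot pairs `slotA m q rA i`, `slotB m q rB j` at least one is LOST. -/
theorem counter_exists_lose (hq : q % 3 ≠ 0) (c : ℕ) (y : Fin (n + 1) → (Fin n → Bool) → Bool)
    (hLm : gadL q ≤ m) (hnB : m + gadL q ≤ n)
    (hA : ∀ g : Fin (n + 1), g.val ≤ m → ∃ a₀ : (Fin n → Bool) → ℕ → Bool, ∃ A : (Fin n → Bool) → ℕ → Finset (Fin n),
      ∀ u : Fin n → Bool, y g u = Bool.xor (a₀ (fun i => decide (i.val < m) && u i)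
        ((Finset.univ.filter fun i : Fin n => m ≤ i.val ∧ u i = true).card % q))
        (decide (((A (fun i => decide (i.val < m) && u i)
          ((Finset.univ.filter fun i : Fin n => m ≤ i.val ∧ u i = true).card % q)).filter
            fun i : Fin n => m ≤ i.val ∧ u i = true).card % 2 = 1)))
    (hB : ∀ g : Fin (n + 1), m < g.val → ∃ a₀ : (Fin n → Bool) → ℕ → Bool, ∃ A : (Fin n → Bool) → ℕ → Finset (Fin n),
      ∀ u : Fin n → Bool, y g u = Bool.xor (a₀ (fun i => decide (m ≤ i.val) && u i)
        ((Finset.univ.filter fun i : Fin n => i.val < m ∧ u i = true).card % q))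
        (decide (((A (fun i => decide (m ≤ i.val) && u i)
          ((Finset.univ.filter fun i : Fin n => i.val < m ∧ u i = true).card % q)).filter
            fun i : Fin n => i.val < m ∧ u i = true).card % 2 = 1)))
    (rA rB : Fin n → Bool) (hrA : ∀ k, rA k = true → k.val < m - gadL q) (hrB : ∀ k, rB k = true → m + gadL q ≤ k.val) :
    ∃ i j : Fin 3 × Fin 3, ringWinU c y (glue m (slotA m q rA i) (slotB m q rB j)) = false := by
  have hmn : m ≤ n := by omega
  have hwtB : ∀ j : Fin 3 × Fin 3, wtB m (slotB m q rB j) = wtB m rB + gadW q j.1 := wtB_slotB hnB rB hrB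
  have hwtA : ∀ i : Fin 3 × Fin 3, wtA m (slotA m q rA i) = wtA m rA + gadW q i.1 := wtA_slotA hLm hmn rA hrA
  refine configParity m c y (slotA m q rA) (slotB m q rB) (by simp) (by simp) ?_ ?_
  · -- cuts `g ≤ m`: counter-affine in the far bits; all nine far slots share `ρ = (|rB| + 2) mod q`
    intro g hg i b hb
    obtain ⟨a₀, A, hy⟩ := hA g hg
    set v₀ : Fin n → Bool := fun k => decide (k.val < m) && slotA m q rA i k with hv₀
    set ρ₀ : ℕ := (wtB m rB + 2) % q with hρ₀
    set Af : Finset (Fin n) := (A v₀ ρ₀).filter fun k : Fin n => m ≤ k.val with hAf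
    set X : ZMod 2 := indZ (a₀ v₀ ρ₀) + ∑ k ∈ Af, indZ (rB k) with hX
    -- the fire bit of one glued pair
    have hfire1 : ∀ j : Fin 3 × Fin 3, indZ (y g (glue m (slotA m q rA i) (slotB m q rB j)))
        = indZ (a₀ v₀ ρ₀) + ((∑ k ∈ Af, indZ (rB k)) + ∑ k ∈ Af, indZ (gad m q j.1 j.2 k)) := by
      intro j
      have hρ : wtB m (slotB m q rB j) % q = ρ₀ := by rw [hwtB j, gadW_mod]
      rw [hy, own_lt_glue, cnt_ge_glue, hρ, indZ_xor, indZ_decide_odd, filter_ge_glue, card_filter_zmod]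
      simp only [slotB, sum_indZ_addV]
      rfl
    -- the triple sums
    have hfire : ∀ t : Fin 3, (∑ s : Fin 3, indZ (y g (glue m (slotA m q rA i) (slotB m q rB (t, s))))) = X := by
      intro t
      rw [Fin.sum_univ_three, hfire1, hfire1, hfire1]
      have hz : (∑ k ∈ Af, indZ (gad m q t 0 k)) + (∑ k ∈ Af, indZ (gad m q t 1 k))
          + ∑ k ∈ Af, indZ (gad m q t 2 k) = 0 := by
        rw [← sum_add_distrib, ← sum_add_distrib]
        exact sum_eq_zero fun k _ => gad_zero_sum m q t k
      rw [hX]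
      linear_combination hz + (indZ (a₀ v₀ ρ₀) + ∑ k ∈ Af, indZ (rB k)) * QuadPolar.two_eq_zero
    have key := fun b' (hb' : b' < 3) => count_parity3 (fun t => wtB m rB + gadW q t)
      (fun b'' hb'' => card_gadW_eq_one hq (wtB m rB) hb'')
      (fun t s => y g (glue m (slotA m q rA i) (slotB m q rB (t, s)))) X hfire
      (fun j => wtB m (slotB m q rB j)) (fun j => by rw [hwtB j]) hb'
    exact (ZMod.natCast_eq_natCast_iff' _ _ 2).mp ((key b hb).trans (key 0 (by norm_num)).symm)
  · -- cuts `g > m`: counter-affine in the near bits; all nine near slots share `ρ = (|rA| + 2) mod q`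
    intro g hg j a ha
    obtain ⟨a₀, A, hy⟩ := hB g hg
    set v₀ : Fin n → Bool := fun k => decide (m ≤ k.val) && slotB m q rB j k with hv₀
    set ρ₀ : ℕ := (wtA m rA + 2) % q with hρ₀
    set Af : Finset (Fin n) := (A v₀ ρ₀).filter fun k : Fin n => k.val < m with hAf
    set X : ZMod 2 := indZ (a₀ v₀ ρ₀) + ∑ k ∈ Af, indZ (rA k) with hX
    have hfire1 : ∀ i : Fin 3 × Fin 3, indZ (y g (glue m (slotA m q rA i) (slotB m q rB j)))
        = indZ (a₀ v₀ ρ₀) + ((∑ k ∈ Af, indZ (rA k)) + ∑ k ∈ Af, indZ (gad (m - gadL q) q i.1 i.2 k)) := by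
      intro i
      have hρ : wtA m (slotA m q rA i) % q = ρ₀ := by rw [hwtA i, gadW_mod]
      rw [hy, own_ge_glue, cnt_lt_glue, hρ, indZ_xor, indZ_decide_odd, filter_lt_glue, card_filter_zmod]
      simp only [slotA, sum_indZ_addV]
      rfl
    have hfire : ∀ t : Fin 3, (∑ s : Fin 3, indZ (y g (glue m (slotA m q rA (t, s)) (slotB m q rB j)))) = X := by
      intro t
      rw [Fin.sum_univ_three, hfire1, hfire1, hfire1]
      have hz : (∑ k ∈ Af, indZ (gad (m - gadL q) q t 0 k)) + (∑ k ∈ Af, indZ (gad (m - gadL q) q t 1 k))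
          + ∑ k ∈ Af, indZ (gad (m - gadL q) q t 2 k) = 0 := by
        rw [← sum_add_distrib, ← sum_add_distrib]
        exact sum_eq_zero fun k _ => gad_zero_sum (m - gadL q) q t k
      rw [hX]
      linear_combination hz + (indZ (a₀ v₀ ρ₀) + ∑ k ∈ Af, indZ (rA k)) * QuadPolar.two_eq_zero
    have key := fun a' (ha' : a' < 3) => count_parity3 (fun t => wtA m rA + gadW q t)
      (fun b'' hb'' => card_gadW_eq_one hq (wtA m rA) hb'')
      (fun t s => y g (glue m (slotA m q rA (t, s)) (slotB m q rB j))) X hfire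
      (fun i => wtA m (slotA m q rA i)) (fun i => by rw [hwtA i]) ha'
    exact (ZMod.natCast_eq_natCast_iff' _ _ 2).mp ((key a ha).trans (key 0 (by norm_num)).symm)

end Counter

end Summit.QuantumAdvantage.AdviceFreeQNC0.OddConfig
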